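import Mathlib.NumberTheory.AbelSummation
import Mathlib.Analysis.SpecialFunctions.Pow.Deriv
import Mathlib.Analysis.SpecialFunctions.Log.NegMulLog
import Mathlib.MeasureTheory.Integral.IntervalIntegral.IntegrationByParts
import Literature.NumberTheory.Sieve.EulerMascheroniEin
import HarnessLib

/-!
# Partial summation against `1/(p log p)` of a prime sum with main term `−x^β/β`
# (the analytic step of Granville–Mollin 2000, §8)

Topic `Literature/Barriers/Parity`, second layer (theorems only, all PROVED) of the proof of
`Literature.Barriers.Parity.GranvilleMollin2000_prop2` (Granville–Mollin, *Rabinowitsch revisited*, Acta Arith.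
96 (2000), Proposition 2, §8: "using (3.3) with partial summation we obtain
`log ∏_{U < p ≤ T} (1 − ω(p)/p) = −∫_U^T (t − t^β)/(t² log t) dt + o(1) = −∫ (1 − e^{−v})/v dv + o(1)`").
The statement is generic in the arithmetic sequence: if the summatory function
`S(t) = ∑_{k ≤ t} c_k` satisfies `|S(t) + t^{1−κ}/(1−κ)| ≤ A₁ t/log t + A₂ t^{1−ν}` on `[a, b]`
(`e ≤ a ≤ b`, `0 < κ < 1`, `ν > 0`; for Granville–Mollin `c_p = (d/p) log p`, `1 − κ = β`,
`A₁ = K/|d|`, `A₂ = K/η`, `ν = c/log|d|`, by (3.3)), then by Abel summation with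
`f(t) = 1/(t log t)`, integration by parts of the main term and the substitution
`v = κ log t` (`∫ t^{−κ} dt/(t log t) = ∫ e^{−v} dv/v`),
`∑_{a < k ≤ b} c_k/(k log k) = E₁(κ log b) − E₁(κ log a) + O(A₁/log a + A₂ a^{−ν}/(ν log a))`
with explicit constants (`abs_sum_div_mul_log_sub_expIntegralE1_le`), `E₁` being the exponential
integral `Literature.NumberTheory.Sieve.expIntegralE1` of `Literature/NumberTheory/Sieve/EulerMascheroniEin.lean`
(`Ein = γ + log + E₁`).

[cite: GranvilleMollin2000, §8]
-/

noncomputable section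

open Real MeasureTheory Set intervalIntegral

namespace Literature.Barriers.Parity

/-! ### Derivatives -/

/-- `(1/(t log t))' = −(log t + 1)/(t log t)²` for `t > 1`. [folklore] -/
theorem hasDerivAt_inv_mul_log {t : ℝ} (ht : 1 < t) :
    HasDerivAt (fun t : ℝ => (t * Real.log t)⁻¹) (-(Real.log t + 1) / (t * Real.log t) ^ 2) t := by
  have h0 : t * Real.log t ≠ 0 := mul_ne_zero (by linarith) (Real.log_pos ht).ne'
  exact (Real.hasDerivAt_mul_log (show t ≠ 0 by linarith)).inv h0

/-- `(−t^{1−κ}/(1−κ))' = −t^{−κ}` for `t > 0`, `κ ≠ 1`. [folklore] -/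
theorem hasDerivAt_neg_rpow_div {κ t : ℝ} (hκ : κ ≠ 1) (ht : 0 < t) :
    HasDerivAt (fun t : ℝ => -(t ^ (1 - κ)) / (1 - κ)) (-(t ^ (-κ))) t := by
  have h1 : (1 : ℝ) - κ ≠ 0 := sub_ne_zero.mpr (Ne.symm hκ)
  have h : HasDerivAt (fun t : ℝ => -(t ^ (1 - κ)) / (1 - κ))
      (-((1 - κ) * t ^ (1 - κ - 1)) / (1 - κ)) t :=
    ((Real.hasDerivAt_rpow_const (p := 1 - κ) (Or.inl ht.ne')).neg).div_const (1 - κ)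
  refine h.congr_deriv ?_
  rw [show (1 : ℝ) - κ - 1 = -κ by ring]
  field_simp

/-- `(E₁(κ log t))' = −t^{−κ}/(t log t)` for `t > 1`, `κ > 0` (`E₁'(x) = −e^{−x}/x`,
`e^{−κ log t} = t^{−κ}`). [folklore] -/
theorem hasDerivAt_expIntegralE1_comp {κ t : ℝ} (hκ : 0 < κ) (ht : 1 < t) :
    HasDerivAt (fun t : ℝ => Literature.NumberTheory.Sieve.expIntegralE1 (κ * Real.log t)) (-(t ^ (-κ)) / (t * Real.log t)) t := by
  have hlog : 0 < Real.log t := Real.log_pos ht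
  have ht0 : (0 : ℝ) < t := by linarith
  have hu : 0 < κ * Real.log t := mul_pos hκ hlog
  have h : HasDerivAt (Literature.NumberTheory.Sieve.expIntegralE1 ∘ fun y : ℝ => κ * Real.log y)
      (-(Real.exp (-(κ * Real.log t)) / (κ * Real.log t)) * (κ * t⁻¹)) t :=
    (Literature.NumberTheory.Sieve.hasDerivAt_expIntegralE1 hu).comp t ((Real.hasDerivAt_log ht0.ne').const_mul κ)
  have h' := h.congr_deriv (show _ = -(t ^ (-κ)) / (t * Real.log t) from by
    rw [Real.rpow_def_of_pos ht0, show Real.log t * -κ = -(κ * Real.log t) by ring]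
    field_simp)
  exact h'

/-- The antiderivative of the majorant: `(−2A₁/log t − (2A₂/(νL)) t^{−ν})' =
2A₁/(t log² t) + (2A₂/L) t^{−ν−1}` for `t > 1`, `ν ≠ 0`. [folklore] -/
theorem hasDerivAt_majorant {A₁ A₂ ν L t : ℝ} (hν : ν ≠ 0) (ht : 1 < t) :
    HasDerivAt (fun t : ℝ => -2 * A₁ * (Real.log t)⁻¹ - 2 * A₂ / (ν * L) * t ^ (-ν))
      (2 * A₁ / (t * Real.log t ^ 2) + 2 * A₂ / L * t ^ (-ν - 1)) t := by
  have hlog : 0 < Real.log t := Real.log_pos ht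
  have ht0 : (0 : ℝ) < t := by linarith
  have h1 : HasDerivAt (fun t : ℝ => (Real.log t)⁻¹) (-(t⁻¹) / Real.log t ^ 2) t :=
    (Real.hasDerivAt_log ht0.ne').inv hlog.ne'
  have h : HasDerivAt (fun t : ℝ => -2 * A₁ * (Real.log t)⁻¹ - 2 * A₂ / (ν * L) * t ^ (-ν))
      (-2 * A₁ * (-(t⁻¹) / Real.log t ^ 2) - 2 * A₂ / (ν * L) * (-ν * t ^ (-ν - 1))) t :=
    (h1.const_mul (-2 * A₁)).sub
      ((Real.hasDerivAt_rpow_const (p := -ν) (Or.inl ht0.ne')).const_mul (2 * A₂ / (ν * L)))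
  refine h.congr_deriv ?_
  field_simp
  ring

/-! ### Continuity of the kernels on `[a, b]`, `a > 1` -/

/-- On `[a, b]` with `a > 1` all points are `> 1`. [folklore] -/
theorem one_lt_of_mem_Icc {a b t : ℝ} (ha : 1 < a) (ht : t ∈ Set.Icc a b) : 1 < t :=
  lt_of_lt_of_le ha ht.1

/-- `t ↦ −(log t + 1)/(t log t)²` is continuous on `[a, b]`, `a > 1`. [folklore] -/
theorem continuousOn_deriv_inv_mul_log {a b : ℝ} (ha : 1 < a) :
    ContinuousOn (fun t : ℝ => -(Real.log t + 1) / (t * Real.log t) ^ 2) (Set.Icc a b) := by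
  have hsub : Set.Icc a b ⊆ ({0}ᶜ : Set ℝ) := fun t ht h => by
    simp only [Set.mem_singleton_iff] at h; linarith [ht.1]
  have hlog : ContinuousOn Real.log (Set.Icc a b) := Real.continuousOn_log.mono hsub
  refine ((hlog.add continuousOn_const).neg).div ((continuousOn_id.mul hlog).pow 2) fun t ht => ?_
  have h1 := one_lt_of_mem_Icc ha ht
  exact pow_ne_zero 2 (mul_ne_zero (by linarith) (Real.log_pos h1).ne')

/-- `t ↦ 1/(t log t)` is continuous on `[a, b]`, `a > 1`. [folklore] -/
theorem continuousOn_inv_mul_log {a b : ℝ} (ha : 1 < a) :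
    ContinuousOn (fun t : ℝ => (t * Real.log t)⁻¹) (Set.Icc a b) := by
  have hsub : Set.Icc a b ⊆ ({0}ᶜ : Set ℝ) := fun t ht h => by
    simp only [Set.mem_singleton_iff] at h; linarith [ht.1]
  have hlog : ContinuousOn Real.log (Set.Icc a b) := Real.continuousOn_log.mono hsub
  refine (continuousOn_id.mul hlog).inv₀ fun t ht => ?_
  have h1 := one_lt_of_mem_Icc ha ht
  exact mul_ne_zero (by simp only [id]; linarith) (Real.log_pos h1).ne'

/-- `t ↦ t^r` is continuous on `[a, b]`, `a > 1`. [folklore] -/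
theorem continuousOn_rpow_Icc {a b : ℝ} (ha : 1 < a) (r : ℝ) :
    ContinuousOn (fun t : ℝ => t ^ r) (Set.Icc a b) :=
  continuousOn_id.rpow_const fun t ht => Or.inl (by simp only [id]; linarith [ht.1])

/-! ### Abel summation against `1/(t log t)` -/

/-- **Abel summation with `f(t) = 1/(t log t)`**: for `e ≤ a ≤ b` and `S(t) = ∑_{k ≤ t} c_k`,
`∑_{a < k ≤ b} c_k/(k log k) = S(b)/(b log b) − S(a)/(a log a) − ∫_a^b S(t) f'(t) dt`,
`f'(t) = −(log t + 1)/(t log t)²`. [folklore] -/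
theorem sum_div_mul_log_eq_abel (c : ℕ → ℝ) {a b : ℝ} (ha : Real.exp 1 ≤ a) (hab : a ≤ b) :
    ∑ k ∈ Finset.Ioc ⌊a⌋₊ ⌊b⌋₊, c k / (k * Real.log k) =
      (b * Real.log b)⁻¹ * (∑ k ∈ Finset.Icc 0 ⌊b⌋₊, c k) -
        (a * Real.log a)⁻¹ * (∑ k ∈ Finset.Icc 0 ⌊a⌋₊, c k) -
        ∫ t in Set.Ioc a b, (-(Real.log t + 1) / (t * Real.log t) ^ 2) *
          ∑ k ∈ Finset.Icc 0 ⌊t⌋₊, c k := by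
  have ha1 : 1 < a := lt_of_lt_of_le (Real.one_lt_exp_iff.mpr one_pos) ha
  have ha0 : 0 ≤ a := by linarith
  have hderiv : ∀ t ∈ Set.Icc a b, HasDerivAt (fun t : ℝ => (t * Real.log t)⁻¹)
      (-(Real.log t + 1) / (t * Real.log t) ^ 2) t := fun t ht =>
    hasDerivAt_inv_mul_log (one_lt_of_mem_Icc ha1 ht)
  have hf_int : IntegrableOn (deriv fun t : ℝ => (t * Real.log t)⁻¹) (Set.Icc a b) := by
    refine ((continuousOn_deriv_inv_mul_log (b := b) ha1).integrableOn_Icc).congr_fun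
      (fun t ht => ?_) measurableSet_Icc
    exact ((hderiv t ht).deriv).symm
  have h := sum_mul_eq_sub_sub_integral_mul c ha0 hab
    (fun t ht => (hderiv t ht).differentiableAt) hf_int
  have hL : ∑ k ∈ Finset.Ioc ⌊a⌋₊ ⌊b⌋₊, (fun t : ℝ => (t * Real.log t)⁻¹) k * c k =
      ∑ k ∈ Finset.Ioc ⌊a⌋₊ ⌊b⌋₊, c k / (k * Real.log k) :=
    Finset.sum_congr rfl fun k _ => by simp only []; rw [inv_mul_eq_div]
  rw [← hL, h]
  congr 1
  refine setIntegral_congr_fun measurableSet_Ioc fun t ht => ?_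
  rw [(hderiv t ⟨ht.1.le, ht.2⟩).deriv]

/-- Algebra of the boundary terms: `(A₁ t/log t + A₂ t^{1−ν})/(t log t) = A₁/log² t +
A₂ t^{−ν}/log t` for `t > 0`. [folklore] -/
theorem inv_mul_log_mul_bound {A₁ A₂ ν t : ℝ} (ht : 0 < t) (hlog : Real.log t ≠ 0) :
    (t * Real.log t)⁻¹ * (A₁ * t / Real.log t + A₂ * t ^ (1 - ν)) =
      A₁ / Real.log t ^ 2 + A₂ * t ^ (-ν) / Real.log t := by
  have h1 : t ^ (1 - ν) = t * t ^ (-ν) := by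
    rw [sub_eq_add_neg, Real.rpow_add ht, Real.rpow_one]
  rw [h1]
  field_simp

/-- **Partial summation of a prime sum with exceptional main term** (the analytic step of
Granville–Mollin §8, made explicit). Let `S(t) = ∑_{k ≤ t} c_k` satisfy
`|S(t) + t^{1−κ}/(1−κ)| ≤ A₁ t/log t + A₂ t^{1−ν}` for `t ∈ [a, b]`, where `e ≤ a ≤ b`,
`0 < κ < 1`, `ν > 0`, `A₁, A₂ ≥ 0`. Then
`|∑_{a < k ≤ b} c_k/(k log k) − (E₁(κ log b) − E₁(κ log a))| ≤
A₁/log² b + A₂ b^{−ν}/log b + A₁/log² a + A₂ a^{−ν}/log a + 2A₁/log a + 2A₂ a^{−ν}/(ν log a)`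
(Abel summation with `1/(t log t)`; the main term integrates to the exponential integral by
`(E₁(κ log t))' = −t^{−κ}/(t log t)`; the error uses `|f'(t)| ≤ 2/(t² log t)` for `t ≥ e`).
[cite: GranvilleMollin2000, §8] -/
theorem abs_sum_div_mul_log_sub_expIntegralE1_le {c : ℕ → ℝ} {a b κ ν A₁ A₂ : ℝ}
    (ha : Real.exp 1 ≤ a) (hab : a ≤ b) (hκ0 : 0 < κ) (hκ1 : κ < 1) (hν : 0 < ν)
    (hA₁ : 0 ≤ A₁) (hA₂ : 0 ≤ A₂)
    (hS : ∀ t ∈ Set.Icc a b, |∑ k ∈ Finset.Icc 0 ⌊t⌋₊, c k + t ^ (1 - κ) / (1 - κ)| ≤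
      A₁ * t / Real.log t + A₂ * t ^ (1 - ν)) :
    |∑ k ∈ Finset.Ioc ⌊a⌋₊ ⌊b⌋₊, c k / (k * Real.log k) -
        (Literature.NumberTheory.Sieve.expIntegralE1 (κ * Real.log b) - Literature.NumberTheory.Sieve.expIntegralE1 (κ * Real.log a))| ≤
      A₁ / Real.log b ^ 2 + A₂ * b ^ (-ν) / Real.log b +
        (A₁ / Real.log a ^ 2 + A₂ * a ^ (-ν) / Real.log a) +
        (2 * A₁ / Real.log a + 2 * A₂ * a ^ (-ν) / (ν * Real.log a)) := by
  -- basic inequalities on `[a, b]`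
  have ha1 : 1 < a := lt_of_lt_of_le (Real.one_lt_exp_iff.mpr one_pos) ha
  have hb1 : 1 < b := lt_of_lt_of_le ha1 hab
  have hmem : ∀ t ∈ Set.Icc a b, 1 < t ∧ 0 < t ∧ 1 ≤ Real.log t := fun t ht => by
    have h1 := one_lt_of_mem_Icc ha1 ht
    refine ⟨h1, by linarith, ?_⟩
    rw [Real.le_log_iff_exp_le (by linarith)]
    exact ha.trans ht.1
  have haI : a ∈ Set.Icc a b := ⟨le_rfl, hab⟩
  have hbI : b ∈ Set.Icc a b := ⟨hab, le_rfl⟩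
  obtain ⟨-, ha0, hla⟩ := hmem a haI
  obtain ⟨-, hb0, hlb⟩ := hmem b hbI
  -- the players
  set S : ℝ → ℝ := fun t => ∑ k ∈ Finset.Icc 0 ⌊t⌋₊, c k with hSdef
  set f : ℝ → ℝ := fun t => (t * Real.log t)⁻¹ with hfdef
  set f' : ℝ → ℝ := fun t => -(Real.log t + 1) / (t * Real.log t) ^ 2 with hf'def
  set g : ℝ → ℝ := fun t => -(t ^ (1 - κ)) / (1 - κ) with hgdef
  set g' : ℝ → ℝ := fun t => -(t ^ (-κ)) with hg'def
  set E : ℝ → ℝ := fun t => S t - g t with hEdef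
  set F : ℝ → ℝ := fun t => Literature.NumberTheory.Sieve.expIntegralE1 (κ * Real.log t) with hFdef
  set m₂ : ℝ → ℝ := fun t => 2 * A₁ / (t * Real.log t ^ 2) + 2 * A₂ / Real.log a * t ^ (-ν - 1)
    with hm₂def
  set M : ℝ → ℝ := fun t => -2 * A₁ * (Real.log t)⁻¹ - 2 * A₂ / (ν * Real.log a) * t ^ (-ν)
    with hMdef
  -- `E = S + t^{1-κ}/(1-κ)` is bounded by `B`
  have hE : ∀ t ∈ Set.Icc a b, |E t| ≤ A₁ * t / Real.log t + A₂ * t ^ (1 - ν) := by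
    intro t ht
    have : E t = ∑ k ∈ Finset.Icc 0 ⌊t⌋₊, c k + t ^ (1 - κ) / (1 - κ) := by
      simp only [hEdef, hSdef, hgdef, neg_div]; ring
    rw [this]; exact hS t ht
  -- derivatives on `[a, b]`
  have hf : ∀ t ∈ Set.uIcc a b, HasDerivAt f (f' t) t := fun t ht =>
    hasDerivAt_inv_mul_log (hmem t (by rwa [Set.uIcc_of_le hab] at ht)).1
  have hg : ∀ t ∈ Set.uIcc a b, HasDerivAt g (g' t) t := fun t ht =>
    hasDerivAt_neg_rpow_div hκ1.ne (hmem t (by rwa [Set.uIcc_of_le hab] at ht)).2.1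
  have hF : ∀ t ∈ Set.uIcc a b, HasDerivAt F (f t * g' t) t := fun t ht => by
    have h1 := (hmem t (by rwa [Set.uIcc_of_le hab] at ht)).1
    refine (hasDerivAt_expIntegralE1_comp hκ0 h1).congr_deriv ?_
    simp only [hfdef, hg'def]
    rw [div_eq_inv_mul, mul_comm]
  have hMd : ∀ t ∈ Set.uIcc a b, HasDerivAt M (m₂ t) t := fun t ht =>
    hasDerivAt_majorant hν.ne' (hmem t (by rwa [Set.uIcc_of_le hab] at ht)).1
  -- continuity / integrability
  have hf'c : ContinuousOn f' (Set.Icc a b) := continuousOn_deriv_inv_mul_log ha1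
  have hfc : ContinuousOn f (Set.Icc a b) := continuousOn_inv_mul_log ha1
  have hgc : ContinuousOn g (Set.Icc a b) := ((continuousOn_rpow_Icc ha1 _).neg).div_const _
  have hg'c : ContinuousOn g' (Set.Icc a b) := (continuousOn_rpow_Icc ha1 _).neg
  have hm₂c : ContinuousOn m₂ (Set.Icc a b) := by
    have hsub : Set.Icc a b ⊆ ({0}ᶜ : Set ℝ) := fun t ht h => by
      simp only [Set.mem_singleton_iff] at h; linarith [ht.1]
    have hlog : ContinuousOn Real.log (Set.Icc a b) := Real.continuousOn_log.mono hsub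
    refine (continuousOn_const.div (continuousOn_id.mul (hlog.pow 2)) fun t ht => ?_).add
      (continuousOn_const.mul (continuousOn_rpow_Icc ha1 _))
    have h := hmem t ht
    exact mul_ne_zero (by simp only [id]; linarith) (pow_ne_zero 2 (by linarith))
  have hf'i : IntervalIntegrable f' volume a b := hf'c.intervalIntegrable_of_Icc hab
  have hg'i : IntervalIntegrable g' volume a b := hg'c.intervalIntegrable_of_Icc hab
  have hf'gi : IntervalIntegrable (fun t => f' t * g t) volume a b :=
    (hf'c.mul hgc).intervalIntegrable_of_Icc hab
  have hfg'i : IntervalIntegrable (fun t => f t * g' t) volume a b :=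
    (hfc.mul hg'c).intervalIntegrable_of_Icc hab
  have hf'S : IntegrableOn (fun t => f' t * S t) (Set.Ioc a b) :=
    (integrableOn_mul_sum_Icc c ha0.le (hf'c.integrableOn_Icc)).mono_set Set.Ioc_subset_Icc_self
  have hf'gI : IntegrableOn (fun t => f' t * g t) (Set.Ioc a b) :=
    ((hf'c.mul hgc).integrableOn_Icc).mono_set Set.Ioc_subset_Icc_self
  have hf'E : IntegrableOn (fun t => f' t * E t) (Set.Ioc a b) := by
    have := hf'S.sub hf'gI
    refine this.congr_fun (fun t _ => ?_) measurableSet_Ioc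
    simp only [hEdef, Pi.sub_apply]; ring
  have hm₂I : IntegrableOn m₂ (Set.Ioc a b) :=
    (hm₂c.integrableOn_Icc).mono_set Set.Ioc_subset_Icc_self
  -- (1) Abel summation
  have hAbel : ∑ k ∈ Finset.Ioc ⌊a⌋₊ ⌊b⌋₊, c k / (k * Real.log k) =
      f b * S b - f a * S a - ∫ t in Set.Ioc a b, f' t * S t :=
    sum_div_mul_log_eq_abel c ha hab
  -- (2) integration by parts of the main term and (3) the exponential integral
  have hIBP : ∫ t in a..b, f' t * g t + f t * g' t = f b * g b - f a * g a :=
    integral_deriv_mul_eq_sub hf hg hf'i hg'i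
  have hFTC : ∫ t in a..b, f t * g' t = F b - F a :=
    integral_eq_sub_of_hasDerivAt hF hfg'i
  have hmain : ∫ t in Set.Ioc a b, f' t * g t = f b * g b - f a * g a - (F b - F a) := by
    rw [← integral_of_le hab, ← hFTC, ← hIBP, integral_add hf'gi hfg'i]
    ring
  -- (4) split the Abel integral
  have hsplit : ∫ t in Set.Ioc a b, f' t * S t =
      (∫ t in Set.Ioc a b, f' t * g t) + ∫ t in Set.Ioc a b, f' t * E t := by
    rw [← integral_add hf'gI hf'E]
    refine setIntegral_congr_fun measurableSet_Ioc fun t _ => ?_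
    simp only [hEdef]; ring
  -- (5) the identity
  have hid : ∑ k ∈ Finset.Ioc ⌊a⌋₊ ⌊b⌋₊, c k / (k * Real.log k) - (F b - F a) =
      f b * E b - f a * E a - ∫ t in Set.Ioc a b, f' t * E t := by
    rw [hAbel, hsplit, hmain]
    simp only [hEdef]
    ring
  -- (6) the boundary terms
  have hbd : ∀ t ∈ Set.Icc a b, |f t * E t| ≤ A₁ / Real.log t ^ 2 + A₂ * t ^ (-ν) / Real.log t := by
    intro t ht
    obtain ⟨h1, h0, hl⟩ := hmem t ht
    have hfpos : 0 < f t := inv_pos.mpr (mul_pos h0 (by linarith))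
    rw [abs_mul, abs_of_pos hfpos, ← inv_mul_log_mul_bound h0 (by linarith)]
    exact mul_le_mul_of_nonneg_left (hE t ht) hfpos.le
  -- (7) the integral term: pointwise majorant
  have hpt : ∀ t ∈ Set.Ioc a b, |f' t * E t| ≤ m₂ t := by
    intro t ht
    have ht' : t ∈ Set.Icc a b := ⟨ht.1.le, ht.2⟩
    obtain ⟨h1, h0, hl⟩ := hmem t ht'
    have hlogpos : 0 < Real.log t := by linarith
    have hlat : Real.log a ≤ Real.log t := Real.log_le_log ha0 ht.1.le
    have hlapos : 0 < Real.log a := by linarith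
    -- `|f' t| ≤ 2/(t² log t)`
    have hf'abs : |f' t| ≤ 2 / (t ^ 2 * Real.log t) := by
      have hden : 0 < (t * Real.log t) ^ 2 := by positivity
      simp only [hf'def]
      rw [abs_div, abs_neg, abs_of_pos (by linarith : 0 < Real.log t + 1), abs_of_pos hden,
        div_le_div_iff₀ hden (by positivity)]
      have : (Real.log t + 1) * (t ^ 2 * Real.log t) ≤ 2 * Real.log t * (t ^ 2 * Real.log t) :=
        mul_le_mul_of_nonneg_right (by linarith) (by positivity)
      calc (Real.log t + 1) * (t ^ 2 * Real.log t) ≤ 2 * Real.log t * (t ^ 2 * Real.log t) := this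
        _ = 2 * (t * Real.log t) ^ 2 := by ring
    have hEt := hE t ht'
    have hBnn : 0 ≤ A₁ * t / Real.log t + A₂ * t ^ (1 - ν) := by positivity
    calc |f' t * E t| = |f' t| * |E t| := abs_mul _ _
      _ ≤ 2 / (t ^ 2 * Real.log t) * (A₁ * t / Real.log t + A₂ * t ^ (1 - ν)) :=
          mul_le_mul hf'abs hEt (abs_nonneg _) (by positivity)
      _ = 2 * A₁ / (t * Real.log t ^ 2) + 2 * A₂ / Real.log t * t ^ (-ν - 1) := by
          have h2 : t ^ (1 - ν) = t ^ 2 * t ^ (-ν - 1) := by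
            rw [show (1 : ℝ) - ν = 2 + (-ν - 1) by ring, Real.rpow_add h0,
              show (2 : ℝ) = (2 : ℕ) by norm_num, Real.rpow_natCast]
          rw [h2]
          field_simp
      _ ≤ m₂ t := by
          simp only [hm₂def]
          gcongr _ + ?_
          apply mul_le_mul_of_nonneg_right _ (Real.rpow_nonneg h0.le _)
          exact div_le_div_of_nonneg_left (by positivity) hlapos hlat
  have hint : |∫ t in Set.Ioc a b, f' t * E t| ≤ ∫ t in Set.Ioc a b, m₂ t := by
    have h := norm_integral_le_of_norm_le (μ := volume.restrict (Set.Ioc a b))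
      (f := fun t => f' t * E t) (g := m₂) hm₂I
      ((ae_restrict_iff' measurableSet_Ioc).mpr (Filter.Eventually.of_forall fun t ht => by
        rw [Real.norm_eq_abs]; exact hpt t ht))
    rwa [Real.norm_eq_abs] at h
  have hm₂int : ∫ t in Set.Ioc a b, m₂ t = M b - M a := by
    rw [← integral_of_le hab]
    exact integral_eq_sub_of_hasDerivAt hMd (hm₂c.intervalIntegrable_of_Icc hab)
  have hMdiff : M b - M a ≤ 2 * A₁ / Real.log a + 2 * A₂ * a ^ (-ν) / (ν * Real.log a) := by
    have hlapos : 0 < Real.log a := by linarith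
    have hlbpos : 0 < Real.log b := by linarith
    have h1 : 0 ≤ 2 * A₁ * (Real.log b)⁻¹ := by positivity
    have h2 : 0 ≤ 2 * A₂ / (ν * Real.log a) * b ^ (-ν) := by positivity
    have : M b - M a = 2 * A₁ * (Real.log a)⁻¹ + 2 * A₂ / (ν * Real.log a) * a ^ (-ν) -
        (2 * A₁ * (Real.log b)⁻¹ + 2 * A₂ / (ν * Real.log a) * b ^ (-ν)) := by
      simp only [hMdef]; ring
    rw [this]
    have : 2 * A₁ * (Real.log a)⁻¹ + 2 * A₂ / (ν * Real.log a) * a ^ (-ν) =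
        2 * A₁ / Real.log a + 2 * A₂ * a ^ (-ν) / (ν * Real.log a) := by
      rw [div_eq_mul_inv (2 * A₁)]; ring
    linarith
  -- (8) conclusion
  rw [hid]
  calc |f b * E b - f a * E a - ∫ t in Set.Ioc a b, f' t * E t|
      ≤ |f b * E b| + |f a * E a| + |∫ t in Set.Ioc a b, f' t * E t| := by
        exact (abs_sub _ _).trans (add_le_add (abs_sub _ _) le_rfl)
    _ ≤ (A₁ / Real.log b ^ 2 + A₂ * b ^ (-ν) / Real.log b) +
        (A₁ / Real.log a ^ 2 + A₂ * a ^ (-ν) / Real.log a) +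
        (2 * A₁ / Real.log a + 2 * A₂ * a ^ (-ν) / (ν * Real.log a)) := by
        gcongr
        · exact hbd b hbI
        · exact hbd a haI
        · exact hint.trans (hm₂int.le.trans hMdiff)

end Literature.Barriers.Parity
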